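import Literature.NumberTheory.GaloisRepresentations.IdeleClassBarModAlphaOne
import Literature.NumberTheory.GaloisRepresentations.IdeleClassBarModAlphaOneSurjective
import Literature.NumberTheory.GaloisRepresentations.IdeleClassBarTateDualityOfInvariant
import Literature.NumberTheory.GaloisRepresentations.IdeleClassBarInvariant
import Literature.NumberTheory.GaloisRepresentations.AbsGaloisGroupCompact
import HarnessLib

/-!
# The hypotheses of Tate's duality theorem HOLD for the idèle class formation `(Γ_F, C̄, inv_F)` of a number field:
# `α¹(U, ℤ/m)` is bijective at every open normal `U` (Milne ADT I Thm. 1.8 (b)), hence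
# `TateDualityHypotheses (classBarD F) (classBarInvD F)` and Tate duality for finite modules (Milne I Thm. 1.8; Harari 16.21)

Topic `NumberTheory/GaloisRepresentations`; namespace `Literature.NumberTheory.GaloisRepresentations.IdeleClassBar`.
Assembly file (theorems only; no definition, no named fact, no instance, no notation, no `sorry`) of the Route A
(A5)-ARITH chain of cell bsd-schneider: door-c4 g15's abstract duality theorem (`DiscreteRepTateDuality`:
`TateDualityHypotheses`, `tateDuality_finite`, `adjointMap_one_injective`), door-c6 g15's discharges of its cohomological
fields for `C̄` (`IdeleClassBarTateDualityOfInvariant.tateDualityHypotheses_classBarD`: `H¹(U, C̄) = 0`,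
`Hʳ(U, C̄) = 0 (r ≥ 3)`, Lemma 1.9), door-c4 g16's invariant map (`IdeleClassBarInvariantSubgroup`: `classBarInvD F`,
`invAt_classBarD_bijective`) and injectivity half of Milne's (b) (`IdeleClassBarModAlphaOne`:
`adjointInjective_one_zmod_classBarD`), and door-c4 g17's surjectivity half (`IdeleClassBarModAlphaOneSurjective`:
`exists_hom_forall_layer_value_eq`).

* **`adjointSurjective_one_zmod_classData`** — `α¹(U, ℤ/m) : Ext¹_{C_U}(ℤ/m, Res_U C̄) → Hom(Ext¹_{C_U}(ℤ, ℤ/m), ℚ/ℤ)` is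
  SURJECTIVE for every open normal `U ≤ Γ_F` and `m ≥ 1` (door-c4 g16's criterion `adjointSurjective_triv_zmod_of_cofinal`
  over the cofinal trace layers `U_E ∩ U_L` of `U = U_L`, with `Ext¹_{C_U}(ℤ, Res C̄) = 0` (door-c6 g15) and the arithmetic
  input `exists_hom_forall_layer_value_eq` — global class field theory, door-c6 g14);
* **`adjointBijective_one_zmod_classBarD`** — Milne's (b) for the idèle class formation: the field
  `adjointBijective_one_zmod` of `TateDualityHypotheses (classBarD F) (classBarInvD F)`;
* **`tateDualityHypotheses_classBarD_classBarInvD : TateDualityHypotheses (classBarD F) (classBarInvD F)`** — ALL SEVEN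
  fields;
* **`tateDuality_classBarD_classBarInvD`** — Tate duality for `(Γ_F, C̄)`: for every finite discrete `Γ_F`-module `M`,
  `α²(Γ_F, M) : Hom(M, C̄)^… = Ext⁰… `—precisely: `α^r(Γ_F, M) : Ext^r_{C_Γ}(M, C̄) → Hom(Ext^{2−r}_{C_Γ}(ℤ, M), ℚ/ℤ)` is
  bijective for `r = 2, 1`, and `Ext³_{C_Γ}(M, C̄) = 0`;
* **`adjointMap_one_injective_classBarD_classBarInvD`** — in particular `α¹(Γ_F, M)` is injective for every finite `M`:
  the input `hα` of Milne I 4.10 (b) `Ker γ¹ ⊆ Im β¹` (door-c4 g15 `ExtDualityKernelImage`, door-c6 g16's F8 skeleton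
  `middleExact_allPlaces_of_readout`) — i.e. of hE = `poitouTate_selmerStructure_duality` behind the stubs of crux 19295.

HONEST FRAMING: this is Tate's duality theorem for the idèle class formation (Tate 1962 / Milne ADT I Thm. 1.8 for
`(Γ_F, C̄)`), assembled in the tree's `Ext`-language from global class field theory typed by the cell; it is NOT yet
Poitou–Tate duality for a finite Galois module `M` and the `S`-idèle classes (Milne I 4.10 — the remaining (A3)/(A6)
steps: `Ext¹(M^D, J̄) = P¹`, the idèle readout), and no case of BSD is proved.  Route A (A5) of crux `AnticycControlAdditiveK`
(item 19295, cell bsd-schneider), seat door-c4 gen 17.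

## References
* J. S. Milne, *Arithmetic Duality Theorems* (2nd ed. 2006), I §1 Theorem 1.8, Lemma 1.9; §4 Theorem 4.10. [MilneADT2006]
* J. Tate, *Duality theorems in Galois cohomology over number fields*, Proc. ICM Stockholm 1962 (1963), 288–295. [Tate1963DualityICM]
* D. Harari, *Galois Cohomology and Class Field Theory* (2020), §16.3 Theorem 16.21. [Harari2020]
* J. W. S. Cassels, A. Fröhlich (eds.), *Algebraic Number Theory* (1967), Ch. VII (J. Tate) §5.1, §11.3. [CasselsFrohlichANT1967]
-/

noncomputable section

open NumberField CategoryTheory CategoryTheory.Abelian groupCohomology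
open Field (absoluteGaloisGroup)
open Literature.NumberTheory.Automorphic Literature.NumberTheory.Automorphic.IdeleClassGroup
open Literature.NumberTheory.NumberFields
open Literature.Algebra.Homology Literature.Algebra.Homology.DiscreteRep Literature.Algebra.Homology.ExtDuality
open scoped Classical

/-! ## §42'. `α`-injectivity only depends on the invariant map up to injective maps -/

namespace Literature.Algebra.Homology.ExtDuality

universe w' v' u'

variable {𝒞 : Type u'} [Category.{v'} 𝒞] [Abelian 𝒞] [HasExt.{w'} 𝒞] {P C : 𝒞}
  {Q Q' : Type} [AddCommGroup Q] [AddCommGroup Q'] {inv : Ext P C 2 →+ Q} {inv' : Ext P C 2 →+ Q'}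

/-- **`α`-injectivity transfers along injective invariant maps**: if `αʳ(M)` for `inv'` is injective and `inv` is
injective, then `αʳ(M)` for `inv` is injective (`⟨x, y⟩_{inv} = ⟨x', y⟩_{inv}` for all `y` gives `y ∘ x = y ∘ x'`, hence
`⟨x, y⟩_{inv'} = ⟨x', y⟩_{inv'}`).  Used to pass between the two spellings `classBarInv` / `classBarInvD` of the invariant
map of the idèle class formation. [cite: Harari2020, §16.3 Theorem 16.21] -/
theorem AdjointInjective.of_injective_inv (M : 𝒞) {r s : ℕ} (h : s + r = 2)
    (H : AdjointInjective inv' M h) (hinv : Function.Injective inv) : AdjointInjective inv M h := by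
  intro x x' hxx'
  refine H (AddMonoidHom.ext fun y => ?_)
  have hy := congrArg (fun f : Ext P M s →+ Q => f y) hxx'
  simp only [adjointMap, pairing_apply] at hy ⊢
  exact congrArg inv' (hinv hy)

end Literature.Algebra.Homology.ExtDuality

namespace Literature.NumberTheory.GaloisRepresentations

namespace IdeleClassBar

section Hypotheses

variable (F : Type) [Field F] [NumberField F]
variable [CompactSpace (absoluteGaloisGroup F)] [TotallyDisconnectedSpace (absoluteGaloisGroup F)]

/-! ## §43. The surjectivity half of `α¹(U, ℤ/m)` bijective -/

/-- **`α¹(U, ℤ/m)` is surjective for the idèle class formation**, at every open normal `U ≤ Γ_F` and every `m ≥ 1`: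
`ExtDuality.AdjointSurjective (invAt C̄ inv_F U) (ℤ/m)` in bidegree `(1, 1)` (`C̄ = (classData F).toSystem.toD`).  Proof:
`U = U_L` (door-c5 `GalLayer.ofOpenNormalSubgroup`); door-c4 g16's criterion `adjointSurjective_triv_zmod_of_cofinal` over
the cofinal family of trace layers `U_E ∩ U_L` (`isCompatibleFamily_relLayerInv`), with `Ext¹_{C_U}(ℤ, Res C̄) = 0`
(door-c6 g15) and the arithmetic input `exists_hom_forall_layer_value_eq` (door-c4 g17: door-c6 g14's class field
theory through the layer dictionary). [cite: MilneADT2006, I Theorem 1.8 (b)][cite: CasselsFrohlichANT1967, Ch. VII §11.3, §5.1] -/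
theorem adjointSurjective_one_zmod_classData (U : OpenNormalSubgroup (absoluteGaloisGroup F)) {m : ℕ} (hm : 0 < m) :
    ExtDuality.AdjointSurjective (DiscreteRep.invAt (classData F).toSystem.toD (classBarInvD F) U)
      (triv (k := ℤ) (Γ := (U : Subgroup (absoluteGaloisGroup F))) (ZMod m)) (show 1 + 1 = 2 from rfl) := by
  -- `U = U_L`
  obtain ⟨L, rfl⟩ : ∃ L : GalLayer F, L.openNormalSubgroup = U :=
    ⟨GalLayer.ofOpenNormalSubgroup U, GalLayer.openNormalSubgroup_ofOpenNormalSubgroup U⟩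
  rw [invAt_classData_eq_classBarInvAt]
  haveI : CompactSpace (L.openNormalSubgroup : Subgroup (absoluteGaloisGroup F)) :=
    LayerColimit.compactSpace_subgroup_of_isOpen _ (LayerColimit.coe_isOpen _)
  exact adjointSurjective_triv_zmod_of_cofinal
    ((resD ℤ (L.openNormalSubgroup : Subgroup (absoluteGaloisGroup F))).obj (classData F).toSystem.toD)
    (classBarInvAt F (L.openNormalSubgroup : Subgroup (absoluteGaloisGroup F)) (LayerColimit.coe_isOpen _)) hm
    (fun x => ext_one_res_classBarD_eq_zero (L.openNormalSubgroup : Subgroup (absoluteGaloisGroup F))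
      (LayerColimit.coe_isOpen _) x)
    (subLayerTrace (L.openNormalSubgroup : Subgroup (absoluteGaloisGroup F)))
    (isCompatibleFamily_relLayerInv (U := (L.openNormalSubgroup : Subgroup (absoluteGaloisGroup F)))
      (LayerColimit.coe_isOpen _)).cofinal
    (fun Φ => (exists_hom_forall_layer_value_eq L hm Φ).imp fun φ hφ => fun E χ =>
      hφ E.1 (GalLayer.openNormalSubgroup_le_iff.1 E.2) χ)

/-- The same in door-c5's spelling `classBarD F` of `C̄`. [cite: MilneADT2006, I Theorem 1.8 (b)] -/
theorem adjointSurjective_one_zmod_classBarD (U : OpenNormalSubgroup (absoluteGaloisGroup F)) {m : ℕ} (hm : 0 < m) :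
    ExtDuality.AdjointSurjective (DiscreteRep.invAt (classBarD F) (classBarInvD F) U)
      (triv (k := ℤ) (Γ := (U : Subgroup (absoluteGaloisGroup F))) (ZMod m)) (show 1 + 1 = 2 from rfl) :=
  adjointSurjective_one_zmod_classData F U hm

/-! ## §44. Milne's (b) and the full record of hypotheses -/

/-- **Milne's hypothesis (b) for the idèle class formation**: `α¹(U, ℤ/m)` is BIJECTIVE for every open normal `U ≤ Γ_F`
and every `m ≥ 1` — verbatim the field `adjointBijective_one_zmod` of `TateDualityHypotheses (classBarD F) (classBarInvD F)`
(injectivity: door-c4 g16 `adjointInjective_one_zmod_classBarD`; surjectivity: §43).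
[cite: MilneADT2006, I Theorem 1.8 (b)][cite: CasselsFrohlichANT1967, Ch. VII §11.3, §5.1 Main Theorem (B), (D)] -/
theorem adjointBijective_one_zmod_classBarD (U : OpenNormalSubgroup (absoluteGaloisGroup F)) {m : ℕ} (hm : 0 < m) :
    ExtDuality.AdjointBijective (DiscreteRep.invAt (classBarD F) (classBarInvD F) U)
      (triv (k := ℤ) (Γ := (U : Subgroup (absoluteGaloisGroup F))) (ZMod m)) (show 1 + 1 = 2 from rfl) :=
  ⟨adjointInjective_one_zmod_classBarD F U hm, adjointSurjective_one_zmod_classBarD F U hm⟩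

/-- **THE HYPOTHESES OF TATE'S DUALITY THEOREM HOLD FOR `(Γ_F, C̄, inv_F)`**: all seven fields of door-c4 g15's
`TateDualityHypotheses (classBarD F) (classBarInvD F)` — `ℚ/ℤ` injective (`Module.Baer.of_divisible`), `inv_U` bijective
(door-c4 g16 `invAt_classBarD_bijective`), `H¹(U, C̄) = 0`, `H¹(U, ℤ) = 0`, `Hʳ(U, C̄) = 0 (r ≥ 3)`, Milne's (b)
(`adjointBijective_one_zmod_classBarD`), and Lemma 1.9 `Extʳ(M, C̄) = 0 (r ≥ 4, M finite)` (door-c6 g15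
`tateDualityHypotheses_classBarD`). [cite: MilneADT2006, I Theorem 1.8, Lemma 1.9][cite: Harari2020, §16.3 Theorem 16.21] -/
theorem tateDualityHypotheses_classBarD_classBarInvD : TateDualityHypotheses (classBarD F) (classBarInvD F) :=
  tateDualityHypotheses_classBarD (classBarInvD F) (Module.Baer.of_divisible _) (invAt_classBarD_bijective F)
    fun U _ hm => adjointBijective_one_zmod_classBarD F U hm

/-! ## §45. Tate duality for the idèle class formation -/

/-- **TATE DUALITY FOR `(Γ_F, C̄)`** (Tate 1962; Milne ADT I Thm. 1.8 for the idèle class formation): for every finite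
discrete `Γ_F`-module `M`, the maps `αʳ(Γ_F, M) : Extʳ_{C_Γ}(M, C̄) → Hom(Ext²⁻ʳ_{C_Γ}(ℤ, M), ℚ/ℤ)` induced by the Yoneda
pairing and `inv_F : Ext²_{C_Γ}(ℤ, C̄) ≅ ℚ/ℤ` are bijective for `r = 2` and `r = 1`, and `Ext³_{C_Γ}(M, C̄) = 0`.
[cite: MilneADT2006, I Theorem 1.8][cite: Tate1963DualityICM, Theorem 2.1][cite: Harari2020, §16.3 Theorem 16.21] -/
theorem tateDuality_classBarD_classBarInvD (M : DiscreteRepCat ℤ (absoluteGaloisGroup F)) [Finite M.obj.V] :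
    AdjointBijective (classBarInvD F) M (show 0 + 2 = 2 from rfl) ∧
      AdjointBijective (classBarInvD F) M (show 1 + 1 = 2 from rfl) ∧ ∀ x : Ext M (classBarD F) 3, x = 0 :=
  tateDuality_finite (tateDualityHypotheses_classBarD_classBarInvD F) M

/-- **`α¹(Γ_F, M) : Ext¹_{C_Γ}(M, C̄) → Hom(Ext¹_{C_Γ}(ℤ, M), ℚ/ℤ)` is injective for every finite discrete `Γ_F`-module `M`**
— the input `hα` of Milne I 4.10 (b) (`Ker γ¹ ⊆ Im β¹`; door-c4 g15 `ExtDualityKernelImage`, door-c6 g16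
`middleExact_allPlaces_of_readout`), now UNCONDITIONAL. [cite: MilneADT2006, I Theorem 1.8 (b) and Theorem 4.10 (proof)] -/
theorem adjointMap_one_injective_classBarD_classBarInvD (M : DiscreteRepCat ℤ (absoluteGaloisGroup F)) [Finite M.obj.V] :
    Function.Injective (adjointMap (classBarInvD F) M (show 1 + 1 = 2 from rfl)) :=
  adjointMap_one_injective (tateDualityHypotheses_classBarD_classBarInvD F) M

/-- **The same for door-c4 g16's spelling `classBarInv F` of `inv_F`** (p594651; the map consumed by door-c6 g16's F8
skeleton `middleExact_allPlaces_of_readout` as its hypothesis `hα`): `α¹(Γ_F, M)` for `classBarInv F` is injective for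
every finite `M` (transfer along the injective `classBarInv F`, §42'). [cite: MilneADT2006, I Theorem 1.8 (b) and Theorem 4.10 (proof)] -/
theorem adjointInjective_one_classBarInv (M : DiscreteRepCat ℤ (absoluteGaloisGroup F)) [Finite M.obj.V] :
    AdjointInjective (P := triv (k := ℤ) (Γ := absoluteGaloisGroup F) ℤ) (classBarInv F) M (rfl : 1 + 1 = 2) :=
  AdjointInjective.of_injective_inv (inv' := classBarInvD F) M rfl (adjointMap_one_injective_classBarD_classBarInvD F M)
    (classBarInv_injective F)

end Hypotheses

/-! ## §46. Instance-free forms (`Γ_F` is profinite: `absoluteGaloisGroup_compactSpace`, Krull topology) -/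

section InstanceFree

variable (F : Type) [Field F] [NumberField F]

/-- **`hα` of the presentation road, UNCONDITIONALLY**: for every number field `F` and every finite discrete
`Γ_F`-module `M`, `α¹(Γ_F, M) : Ext¹_{C_Γ}(M, C̄) → Hom(Ext¹_{C_Γ}(ℤ, M), ℚ/ℤ)` for `inv_F = classBarInv F` is injective —
verbatim the hypothesis `hα` of door-c6 g16's `middleExact_allPlaces_of_readout` (with `S.X₃ = M`).
[cite: MilneADT2006, I Theorem 1.8 (b) and Theorem 4.10 (proof)][cite: Tate1963DualityICM, Theorem 2.1] -/
theorem adjointInjective_one_classBarInv' (M : DiscreteRepCat ℤ (absoluteGaloisGroup F)) [Finite M.obj.V] :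
    AdjointInjective (P := triv (k := ℤ) (Γ := absoluteGaloisGroup F) ℤ) (classBarInv F) M (rfl : 1 + 1 = 2) := by
  haveI : CompactSpace (absoluteGaloisGroup F) := absoluteGaloisGroup_compactSpace F
  haveI : TotallyDisconnectedSpace (absoluteGaloisGroup F) := inferInstance
  exact adjointInjective_one_classBarInv F M

/-- **Tate duality for `(Γ_F, C̄, inv_F)`, instance-free form.** [cite: MilneADT2006, I Theorem 1.8][cite: Tate1963DualityICM, Theorem 2.1] -/
theorem tateDuality_classBarD_classBarInvD' (M : DiscreteRepCat ℤ (absoluteGaloisGroup F)) [Finite M.obj.V] :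
    haveI : CompactSpace (absoluteGaloisGroup F) := absoluteGaloisGroup_compactSpace F
    AdjointBijective (classBarInvD F) M (show 0 + 2 = 2 from rfl) ∧
      AdjointBijective (classBarInvD F) M (show 1 + 1 = 2 from rfl) ∧ ∀ x : Ext M (classBarD F) 3, x = 0 := by
  haveI : CompactSpace (absoluteGaloisGroup F) := absoluteGaloisGroup_compactSpace F
  haveI : TotallyDisconnectedSpace (absoluteGaloisGroup F) := inferInstance
  exact tateDuality_classBarD_classBarInvD F M

end InstanceFree

end IdeleClassBar

end Literature.NumberTheory.GaloisRepresentations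

end
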